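/-
Origin: expansion seat `planner-pub-hodgecm-mc-theta-3-g11-0`, handover (F2) 2026-08-20T03:10Z md5 9cefb4fd0b6a083e7f8eeccf783fdf67 (202 l.; NEW additive leaf over (F1); the four slot conditions hpos₀…₃ of `archLineDatumOf` collapse under `GoodCtx h ι₁ c` to ONE orientation Prop `0 < im((InfinitePlace.mk ι₁).embedding (imagUnit L)) ↔ h = false`; `archLineDatumOfOrient` = (F1) with hpos DISCHARGED; imports (F1) + installed Binders/GramWRegime) (`HOME/mc/pub-hodgecm-mc-theta-3-g11/lean/stage39/HodgeCM/Model/ArchLineOrient.lean`, md5 9cefb4fd0b6a, 202 lines);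
landed by the gen-14 packager (p-g14) in gate run 39 as `HodgeCM/Model/ArchLineOrient.lean` (verbatim).
-/
/-
Copyright (c) 2026. All rights reserved.
Released under Apache 2.0 license as described in the file LICENSE.
Origin: mc-theta-3 (gen 11), PerL model-construction sub-cell; RUN-40 candidate leaf `Model/ArchLineOrient`.
PerL-specific construction layer (`HodgeCM/Model/…`): no literature is reproduced here and nothing is cited as a fact.
No proof holes; no notation commands (style lint L-notation).
-/
import Summits.HodgeConjecture.HodgeCM.Model.ArchLineDatumOf_3
import Summits.HodgeConjecture.HodgeCM.Model.Binders.GramWRegime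

/-!
# The orientation bit of the four line slots at `v₁` — the four `hposₖ` collapse to ONE Prop about `(L, ι₁, h)`

`Model/ArchLineDatumOf.archLineDatumOf` (RUN 39) constructs E's archimedean line datum `𝔄 V c` from the pin under the
four positivity CONDITIONS
`hposₖ : 0 < cmXW (L : Type) (frameD V) (lineVec (L : Type) dₖ) _ ι₁ (HypCensus.cmPlace (L : Type) ι₁) 0`,
`d = (dW c.D 0, dW c.D 1, dW' c.D 0, dW' c.D 1) = (a₀, a₁, a₂, a₃)` — «line `k` reads POSITIVE at `v₁` in binder-2's canonical
convention», i.e. the slot `eR : PosIdx ≃ Unit`, `eS : NegIdx ≃ Empty` of carch-1's `ArchKTypeOfSlot`.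

This file computes that condition in closed form and shows it is ONE bit, the same for all four lines and free of `V` and `c`:

* `cmXW_cmPlace_lineVec` — `cmXW … (lineVec d) … (cmPlace ι₁) 0 = re ι₁(d) / im ((InfinitePlace.mk ι₁).embedding δ_L)`
  (`δ_L = imagUnit L`; binder-2's `cmCW`, `cmSignConv_cmPlace_eq_one` for the `(2,1)` frame `frameD V`, K-1 `cmPlaceOver_eq_mk`);
* `reqPos_self`, `re_a_pos_iff_of_goodCtx`, `re_a_neg_iff_of_goodCtx` — under `GoodCtx h ι₁ c` ALL FOUR lines have the sign `(-1)^h`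
  at `ι₁`: `0 < re ι₁(aᵢ) ↔ h = false` (`κ(ι₁) = σ ∈ Ψᵢ` for `h = false`, `= σ̄ ∉ Ψᵢ` for `h = true`; sharpens
  `Binders/GramWRegime.re_pos_iff_of_goodCtx`, which only records that the four signs agree);
* `hpos_iff_orient_of_goodCtx` — hence `hposₖ ↔ (0 < im ((InfinitePlace.mk ι₁).embedding δ_L) ↔ h = false)` for every `k`;
* `archLineDatumOfOrient` — `archLineDatumOf` with the four `hposₖ` DISCHARGED from `GoodCtx h ι₁ c` and that one Prop.

WHAT THE ONE PROP IS (for the desk, (TWIST-2) docket): `im ((InfinitePlace.mk ι₁).embedding δ_L)` is the product of the sign of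
Mathlib's representative `(mk ι₁).embedding ∈ {ι₁, conjugate ι₁}` (a `Classical.choice`) and of `im ι₁(δ_L)` (`δ_L = x - x̄`,
`x` a `Classical.choose`) — neither is fixed by `GoodCtx`, so for a given `(L, ι₁)` EXACTLY ONE recipe bit `h` satisfies the Prop.
No statement here decides it; the file only isolates it.
-/

noncomputable section

open NumberField NumberField.InfinitePlace NumberField.mixedEmbedding IsDedekindDomain
open scoped Matrix Classical ComplexConjugate
open Literature.NumberTheory.Automorphic Literature.NumberTheory.Automorphic.UnitaryGroup Literature.NumberTheory.Weil1964
open Literature.NumberTheory.GelbartRogawski1991 Literature.NumberTheory.GelbartRogawski1991.UnitaryDualPair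
open HodgeCM.Adelic HodgeCM.PerL34 HodgeCM.Model.HypCensus HodgeCM.Model.SupplyInstance

/-! ## § 1 The forced sign of the four lines at `ι₁` is `(-1)^h` -/

namespace HodgeCM.Model.ArchSideTerm

open HodgeCM.SignRecipe

section ForcedSign

variable (h : Bool) {K L : CMField} (j : K →+* L) (ι₁ : L →+* ℂ)

/-- at `τ = ι₁` the required sign of a line whose type contains `σ = ι₁ ∘ j` is `+` for the recipe bit `false` and `−` for `true`. -/
theorem reqPos_self {Ψ : Literature.AlgebraicGeometry.Motives.CMType K} (hΨ : ι₁.comp j ∈ Ψ.1) :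
    reqPos h K L j ι₁ Ψ ι₁ = !h := by
  have hc : NumberField.ComplexEmbedding.conjugate (ι₁.comp j) ∉ Ψ.1 := (Ψ.2 _).mp hΨ
  cases h
  · simp [reqPos, kappa_self_false, ind, hΨ, frameSign_self]
  · simp [reqPos, kappa_self_true, ind, hc, frameSign_self]

variable {h ι₁}

/-- **under a good context every line is positive at `ι₁` iff the recipe bit is `false`.** -/
theorem re_a_pos_iff_of_goodCtx {c : SeesawCtx L} (hc : SignRecipe.GoodCtx h ι₁ c) (i : Fin 4) :
    0 < (ι₁ (c.D.a i)).re ↔ h = false := by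
  obtain ⟨j, hj, hS⟩ := hc.forced
  have hm : ι₁.comp j ∈ (c.Ψ i).1 := hj ▸ hc.mem i
  rw [hS i ι₁, reqPos_self h j ι₁ hm]
  cases h <;> simp

/-- … and negative at `ι₁` iff the recipe bit is `true`. -/
theorem re_a_neg_iff_of_goodCtx {c : SeesawCtx L} (hc : SignRecipe.GoodCtx h ι₁ c) (i : Fin 4) :
    (ι₁ (c.D.a i)).re < 0 ↔ h = true := by
  have hne := re_embedding_a_ne_zero c ι₁ i
  have hp := re_a_pos_iff_of_goodCtx hc i
  constructor
  · intro hlt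
    cases h
    · exact absurd (hp.2 rfl) (not_lt.2 hlt.le)
    · rfl
  · rintro rfl
    exact lt_of_le_of_ne (not_lt.1 fun hgt => Bool.false_ne_true (hp.1 hgt).symm) hne

end ForcedSign

/-! ## § 2 The slot sign of a line at `v₁` in closed form -/

section SlotSign

variable {L : CMField} {ι₁ : L →+* ℂ} (V : HermSpace3 L ι₁)

/-- **the canonical `W`-sign of the line `⟨d⟩` at the place under `ι₁`, in closed form**:
`x_{⟨d⟩}(v₁) = re ι₁(d) / im ((mk ι₁).embedding δ_L)` (the `(2,1)` frame `frameD V` makes binder-2's `cmSignConv v₁ = 1`). -/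
theorem cmXW_cmPlace_lineVec (d : (L : Type)) (hd : IsCMField.complexConj L d = d) :
    cmXW (L : Type) (frameD V) (lineVec (L : Type) d) (fun _ => hd) ι₁ (HypCensus.cmPlace (L : Type) ι₁) 0 =
      (ι₁ d).re / ((InfinitePlace.mk ι₁).embedding (imagUnit (L : Type))).im := by
  obtain ⟨i₀, -, hV⟩ := frameD_sign_ι₁ V
  show placeSignVec (cmRealVec (L : Type) (lineVec (L : Type) d) fun _ => hd) (cmCW (L : Type) (frameD V) ι₁)
      (HypCensus.cmPlace (L : Type) ι₁) 0 = _
  rw [placeSignVec_cmRealVec (L : Type) (HypCensus.cmPlace (L : Type) ι₁) ι₁ rfl (lineVec (L : Type) d) (fun _ => hd)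
      (cmCW (L : Type) (frameD V) ι₁) 0]
  show (ι₁ d).re / (((cmPlaceOver (L : Type) (HypCensus.cmPlace (L : Type) ι₁)).1.embedding (imagUnit (L : Type))).im /
      cmSignConv (L : Type) (frameD V) ι₁ (HypCensus.cmPlace (L : Type) ι₁)) = _
  rw [cmSignConv_cmPlace_eq_one (L : Type) (frameD V) ι₁ ⟨i₀, hV⟩, div_one,
    cmPlaceOver_eq_mk (L : Type) (HypCensus.cmPlace (L : Type) ι₁) ι₁ rfl]

/-- the denominator is nonzero: `im ((mk ι₁).embedding δ_L) ≠ 0`. -/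
theorem im_embedding_mk_imagUnit_ne_zero : ((InfinitePlace.mk ι₁).embedding (imagUnit (L : Type))).im ≠ 0 := by
  rw [← cmPlaceOver_eq_mk (L : Type) (HypCensus.cmPlace (L : Type) ι₁) ι₁ rfl]
  exact im_embedding_cmPlaceOver_imagUnit_ne_zero (L : Type) (HypCensus.cmPlace (L : Type) ι₁)

/-- elementary: for `x, y ≠ 0`, `0 < x / y ↔ (0 < y ↔ 0 < x)`. -/
theorem div_pos_iff_iff {x y : ℝ} (hx : x ≠ 0) (hy : y ≠ 0) : 0 < x / y ↔ (0 < y ↔ 0 < x) := by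
  rcases lt_or_gt_of_ne hx with hx' | hx' <;> rcases lt_or_gt_of_ne hy with hy' | hy'
  · exact ⟨fun _ => ⟨fun h => absurd h (not_lt.2 hy'.le), fun h => absurd h (not_lt.2 hx'.le)⟩,
      fun _ => div_pos_of_neg_of_neg hx' hy'⟩
  · exact ⟨fun h => absurd h (not_lt.2 (div_neg_of_neg_of_pos hx' hy').le), fun h => absurd (h.1 hy') (not_lt.2 hx'.le)⟩
  · exact ⟨fun h => absurd h (not_lt.2 (div_neg_of_pos_of_neg hx' hy').le), fun h => absurd (h.2 hx') (not_lt.2 hy'.le)⟩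
  · exact ⟨fun _ => ⟨fun _ => hx', fun _ => hy'⟩, fun _ => div_pos hx' hy'⟩

/-- **the slot sign of a context line at `v₁` is ONE bit**: under `GoodCtx h ι₁ c`, line `⟨aᵢ⟩` reads positive at `v₁` iff
`0 < im ((mk ι₁).embedding δ_L) ↔ h = false` — the same Prop for all four `i`, free of `V` and of `c`. -/
theorem hpos_iff_orient_of_goodCtx {h : Bool} {c : SeesawCtx L} (hc : SignRecipe.GoodCtx h ι₁ c) (i : Fin 4)
    (hd : IsCMField.complexConj L (c.D.a i) = c.D.a i) :
    0 < cmXW (L : Type) (frameD V) (lineVec (L : Type) (c.D.a i)) (fun _ => hd) ι₁ (HypCensus.cmPlace (L : Type) ι₁) 0 ↔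
      (0 < ((InfinitePlace.mk ι₁).embedding (imagUnit (L : Type))).im ↔ h = false) := by
  rw [cmXW_cmPlace_lineVec V (c.D.a i) hd,
    div_pos_iff_iff (SignRecipe.re_embedding_a_ne_zero c ι₁ i) (im_embedding_mk_imagUnit_ne_zero (ι₁ := ι₁)),
    re_a_pos_iff_of_goodCtx hc i]

end SlotSign

/-! ## § 3 `archLineDatumOf` with the four `hposₖ` discharged from the context and the one orientation Prop -/

section Datum

variable {L : CMField} {ι₁ : L →+* ℂ} (V : HermSpace3 L ι₁) {h : Bool} (c : SeesawCtx L)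
variable
  (hGR : (cmSplittingDatum (L : Type) finProdFinEquiv (frameD V) (frameD_real V) (frameD_ne V) (dW c.D) (dW_real c.D)
    (dW_ne c.D)).CompatibleSplitting)
  (hGR₀ : (cmSplittingDatum (L : Type) (e₁) (frameD V) (frameD_real V) (frameD_ne V) (lineVec (L : Type) (dW c.D 0))
    (fun _ => dW_real c.D 0) (fun _ => dW_ne c.D 0)).CompatibleSplitting)
  (hGR₁ : (cmSplittingDatum (L : Type) (e₁) (frameD V) (frameD_real V) (frameD_ne V) (lineVec (L : Type) (dW c.D 1))
    (fun _ => dW_real c.D 1) (fun _ => dW_ne c.D 1)).CompatibleSplitting)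
  (hGR₂ : (cmSplittingDatum (L : Type) (e₁) (frameD V) (frameD_real V) (frameD_ne V) (lineVec (L : Type) (dW' c.D 0))
    (fun _ => dW'_real c.D 0) (fun _ => dW'_ne c.D 0)).CompatibleSplitting)
  (hGR₃ : (cmSplittingDatum (L : Type) (e₁) (frameD V) (frameD_real V) (frameD_ne V) (lineVec (L : Type) (dW' c.D 1))
    (fun _ => dW'_real c.D 1) (fun _ => dW'_ne c.D 1)).CompatibleSplitting)
  (η : CMAdelic (L : Type) (frameD V) × CMAdelic (L : Type) (dW c.D) →* ℂˣ)
  (μ : Fin 4 → (InfinitePlace (L : Type) → ℤ))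

/-- the four `hposₖ` from the context and the orientation Prop (`dW c.D j = aⱼ`, `dW' c.D j = a_{j+2}` on the nose). -/
theorem hpos₀_of_orient (hc : SignRecipe.GoodCtx h ι₁ c)
    (hor : 0 < ((InfinitePlace.mk ι₁).embedding (imagUnit (L : Type))).im ↔ h = false) :
    0 < cmXW (L : Type) (frameD V) (lineVec (L : Type) (dW c.D 0)) (fun _ => dW_real c.D 0) ι₁ (HypCensus.cmPlace (L : Type) ι₁) 0 :=
  (hpos_iff_orient_of_goodCtx V hc 0 (dW_real c.D 0)).2 hor

/-- (Ported verbatim from the HodgeCMPerL package; no docstring in the source.) -/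
theorem hpos₁_of_orient (hc : SignRecipe.GoodCtx h ι₁ c)
    (hor : 0 < ((InfinitePlace.mk ι₁).embedding (imagUnit (L : Type))).im ↔ h = false) :
    0 < cmXW (L : Type) (frameD V) (lineVec (L : Type) (dW c.D 1)) (fun _ => dW_real c.D 1) ι₁ (HypCensus.cmPlace (L : Type) ι₁) 0 :=
  (hpos_iff_orient_of_goodCtx V hc 1 (dW_real c.D 1)).2 hor

/-- (Ported verbatim from the HodgeCMPerL package; no docstring in the source.) -/
theorem hpos₂_of_orient (hc : SignRecipe.GoodCtx h ι₁ c)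
    (hor : 0 < ((InfinitePlace.mk ι₁).embedding (imagUnit (L : Type))).im ↔ h = false) :
    0 < cmXW (L : Type) (frameD V) (lineVec (L : Type) (dW' c.D 0)) (fun _ => dW'_real c.D 0) ι₁ (HypCensus.cmPlace (L : Type) ι₁) 0 :=
  (hpos_iff_orient_of_goodCtx V hc 2 (dW'_real c.D 0)).2 hor

/-- (Ported verbatim from the HodgeCMPerL package; no docstring in the source.) -/
theorem hpos₃_of_orient (hc : SignRecipe.GoodCtx h ι₁ c)
    (hor : 0 < ((InfinitePlace.mk ι₁).embedding (imagUnit (L : Type))).im ↔ h = false) :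
    0 < cmXW (L : Type) (frameD V) (lineVec (L : Type) (dW' c.D 1)) (fun _ => dW'_real c.D 1) ι₁ (HypCensus.cmPlace (L : Type) ι₁) 0 :=
  (hpos_iff_orient_of_goodCtx V hc 3 (dW'_real c.D 1)).2 hor

/-- conversely each `hposₖ` GIVES the orientation Prop (so the four conditions are equivalent to each other under `GoodCtx`). -/
theorem orient_of_hpos₀ (hc : SignRecipe.GoodCtx h ι₁ c)
    (hpos₀ : 0 < cmXW (L : Type) (frameD V) (lineVec (L : Type) (dW c.D 0)) (fun _ => dW_real c.D 0) ι₁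
      (HypCensus.cmPlace (L : Type) ι₁) 0) :
    0 < ((InfinitePlace.mk ι₁).embedding (imagUnit (L : Type))).im ↔ h = false :=
  (hpos_iff_orient_of_goodCtx V hc 0 (dW_real c.D 0)).1 hpos₀

/-- **E's archimedean line datum from the pin, the context, the ONE orientation Prop and the four (J-μ) identities**:
`archLineDatumOfOrient V c … η μ hc hor : (hμ₀ : …) → (hμ₁ : …) → (hμ₂ : …) → (hμ₃ : …) → ArchLineDatum V c.D hGR hGR₀ hGR₁ hGR₂ hGR₃ η μ`,
the four remaining binders being VERBATIM the (J-μ) identities `hμₖ` of `archLineDatumOf` (its type is that of `archLineDatumOf`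
with the four `hposₖ` instantiated). -/
def archLineDatumOfOrient (hc : SignRecipe.GoodCtx h ι₁ c)
    (hor : 0 < ((InfinitePlace.mk ι₁).embedding (imagUnit (L : Type))).im ↔ h = false) :=
  archLineDatumOf V c.D hGR hGR₀ hGR₁ hGR₂ hGR₃ η μ (hpos₀_of_orient V c hc hor) (hpos₁_of_orient V c hc hor)
    (hpos₂_of_orient V c hc hor) (hpos₃_of_orient V c hc hor)

/-- read-back: the test vectors of `archLineDatumOfOrient` are those of `archLineDatumOf` (definitional). -/
theorem archLineDatumOfOrient_eq (hc : SignRecipe.GoodCtx h ι₁ c)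
    (hor : 0 < ((InfinitePlace.mk ι₁).embedding (imagUnit (L : Type))).im ↔ h = false) (hμ₀ hμ₁ hμ₂ hμ₃) :
    archLineDatumOfOrient V c hGR hGR₀ hGR₁ hGR₂ hGR₃ η μ hc hor hμ₀ hμ₁ hμ₂ hμ₃ =
      archLineDatumOf V c.D hGR hGR₀ hGR₁ hGR₂ hGR₃ η μ (hpos₀_of_orient V c hc hor) (hpos₁_of_orient V c hc hor)
        (hpos₂_of_orient V c hc hor) (hpos₃_of_orient V c hc hor) hμ₀ hμ₁ hμ₂ hμ₃ :=
  rfl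

end Datum

end HodgeCM.Model.ArchSideTerm

end
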